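import Mathlib.Analysis.SpecialFunctions.Pow.Real
import Mathlib.Algebra.Order.Floor.Defs
import Mathlib.Analysis.Normed.Field.Basic

/-!
# K2 lane (route-2 `SawtoothPulseCascade`, crux dir `K1LocalisedCascade`): the SQUARE SUM of the single-mode creation weights is `O(a)` — the arithmetic of the energy-form (ℓ²) creation law

Helper file of the K2 lane (ACL item stmt-AnomalousDissipation-19491; memo `K2BookReduction-p2.md` §0/§6: the energy-form creation law and the V→V truncation
tails). By `…KHModeCreation` (`mode_factor_le`: `≤ 0.889/a` for every mode) and `…KHModePairedCreation` (`paired_mode_factor_far_le`: `≤ 25.5/(a(1+(|ξ/a|−8)²))`,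
hence `≤ 102·a/ξ²`, for `|ξ| ≥ 16a`) the creation weight of the mode `ξ` on the line `a ≥ 4` is at most
`W(a, ξ) = 0.889/a (|ξ| < 16a)`, `102a/ξ² (|ξ| ≥ 16a)`. This file is pure arithmetic: for every Bloch phase `β` and every window `|n| ≤ K`,
`Σ_{|n| ≤ K} W(a, β+n)²·(a² + (β+n)²) ≤ 8000·a` (`sum_sq_creationWeight_le`) — the constant that Cauchy–Schwarz turns into the energy-form law
`‖q‖² ≤ 8000a · Σ_n ‖c n‖²/(a²+(β+n)²)` for an arbitrary mode profile (uniform in the window: with the envelope law's `5.14/|ξ|` the same sum grows like `K`).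
Ingredients: a window-count (`card_filter_abs_lt_le`: at most `2R+1` lattice modes with `|β+n| < R`) and a telescoping tail (`sum_Icc_tail_inv_sq_le`:
`Σ_{K₀<|n|≤K} 1/(|n|−1)² ≤ 2/(K₀−1)`). No definitions; no statement about the crux. [folklore] [problem: turb]
-/

-- `Summit.<Summit>.<Problem>`: single-conjunct summit, the duplicate namespace segment is deliberate.
set_option linter.dupNamespace false

noncomputable section

namespace Summit.AnomalousDissipation.AnomalousDissipation.Theorems.SawtoothPulseCascade.K2PhaseBudget

/-! ## §1 Counting lattice modes in a band -/

/-- At most `2R+1` integers `n` of any finite set have `|β + n| < R` (`R ≥ 0`). [folklore] -/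
theorem card_filter_abs_lt_le (β : ℝ) {R : ℝ} (hR : 0 ≤ R) (S : Finset ℤ) :
    (((S.filter fun n : ℤ => |β + n| < R).card : ℕ) : ℝ) ≤ 2 * R + 1 := by
  set T := S.filter fun n : ℤ => |β + n| < R with hT
  have hsub : T ⊆ Finset.Icc ⌈-β - R⌉ ⌊-β + R⌋ := by
    intro n hn
    rw [hT, Finset.mem_filter] at hn
    obtain ⟨h1, h2⟩ := abs_lt.1 hn.2
    rw [Finset.mem_Icc]
    exact ⟨Int.ceil_le.2 (by linarith), Int.le_floor.2 (by linarith)⟩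
  have hcard := Finset.card_le_card hsub
  rw [Int.card_Icc] at hcard
  have h1 : ((T.card : ℕ) : ℝ) ≤ (((⌊-β + R⌋ + 1 - ⌈-β - R⌉).toNat : ℕ) : ℝ) := by exact_mod_cast hcard
  refine h1.trans ?_
  have h2 : ((⌊-β + R⌋ + 1 - ⌈-β - R⌉ : ℤ) : ℝ) ≤ 2 * R + 1 := by
    have hf : ((⌊-β + R⌋ : ℤ) : ℝ) ≤ -β + R := Int.floor_le _
    have hc : -β - R ≤ ((⌈-β - R⌉ : ℤ) : ℝ) := Int.le_ceil _
    push_cast; linarith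
  rcases le_or_gt 0 (⌊-β + R⌋ + 1 - ⌈-β - R⌉) with h | h
  · rw [show (((⌊-β + R⌋ + 1 - ⌈-β - R⌉).toNat : ℕ) : ℝ) = ((⌊-β + R⌋ + 1 - ⌈-β - R⌉ : ℤ) : ℝ) by
      rw [← Int.toNat_of_nonneg h]; push_cast; rw [Int.toNat_of_nonneg h]]
    exact h2
  · rw [Int.toNat_eq_zero.2 h.le]; push_cast; linarith

/-! ## §2 The telescoping tail over the window -/

/-- The symmetric window grows by its two end points. [folklore] -/
theorem Icc_neg_succ (K : ℕ) :
    Finset.Icc (-(((K + 1 : ℕ)) : ℤ)) ((K + 1 : ℕ) : ℤ) = insert (-((K : ℤ) + 1)) (insert ((K : ℤ) + 1) (Finset.Icc (-(K : ℤ)) K)) := by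
  ext n
  simp only [Finset.mem_Icc, Finset.mem_insert, Nat.cast_add, Nat.cast_one]
  omega

/-- Splitting a symmetric window sum at the two new end points. [folklore] -/
theorem sum_Icc_neg_succ (f : ℤ → ℝ) (K : ℕ) :
    ∑ n ∈ Finset.Icc (-(((K + 1 : ℕ)) : ℤ)) ((K + 1 : ℕ) : ℤ), f n = f (-((K : ℤ) + 1)) + (f ((K : ℤ) + 1) + ∑ n ∈ Finset.Icc (-(K : ℤ)) K, f n) := by
  rw [Icc_neg_succ, Finset.sum_insert, Finset.sum_insert]
  · simp only [Finset.mem_Icc]; omega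
  · simp only [Finset.mem_insert, Finset.mem_Icc]; omega

/-- **Telescoping tail:** `Σ_{K₀ < |n| ≤ K} 1/(|n|−1)² ≤ 2/(K₀−1)` (`K₀ ≥ 2`), written as a window sum of the indicator-weighted summand. [folklore] -/
theorem sum_Icc_tail_inv_sq_le {K₀ : ℕ} (hK₀ : 2 ≤ K₀) {K : ℕ} (hK : K₀ ≤ K) :
    ∑ n ∈ Finset.Icc (-(K : ℤ)) K, (if n ∈ Finset.Icc (-(K₀ : ℤ)) K₀ then (0 : ℝ) else 1 / ((|(n : ℝ)| - 1) ^ 2)) ≤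
      2 / ((K₀ : ℝ) - 1) - 2 / ((K : ℝ) - 1) := by
  induction K, hK using Nat.le_induction with
  | base => rw [Finset.sum_eq_zero fun n hn => if_pos hn]; simp
  | succ K hKK ih =>
    have hK1 : (1 : ℝ) ≤ (K : ℝ) - 1 := by
      have : (2 : ℝ) ≤ K := by exact_mod_cast hK₀.trans hKK
      linarith
    rw [sum_Icc_neg_succ]
    have hn1 : (-((K : ℤ) + 1)) ∉ Finset.Icc (-(K₀ : ℤ)) K₀ := by rw [Finset.mem_Icc]; omega
    have hn2 : ((K : ℤ) + 1) ∉ Finset.Icc (-(K₀ : ℤ)) K₀ := by rw [Finset.mem_Icc]; omega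
    rw [if_neg hn1, if_neg hn2]
    have e1 : |((-((K : ℤ) + 1) : ℤ) : ℝ)| - 1 = K := by push_cast; rw [abs_of_neg (by linarith)]; ring
    have e2 : |((((K : ℤ) + 1) : ℤ) : ℝ)| - 1 = K := by push_cast; rw [abs_of_pos (by linarith)]; ring
    rw [e1, e2]
    push_cast
    have hK0 : (0 : ℝ) < K := by linarith
    have key : 1 / (K : ℝ) ^ 2 + 1 / (K : ℝ) ^ 2 ≤ 2 / ((K : ℝ) - 1) - 2 / ((K : ℝ) + 1 - 1) := by
      rw [show (K : ℝ) + 1 - 1 = K by ring, show 2 / ((K : ℝ) - 1) - 2 / K = 2 / (((K : ℝ) - 1) * K) by field_simp; ring,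
        show 1 / (K : ℝ) ^ 2 + 1 / (K : ℝ) ^ 2 = 2 / ((K : ℝ) ^ 2) by ring]
      exact div_le_div_of_nonneg_left (by norm_num) (by nlinarith) (by nlinarith)
    linarith

/-- The far tail of the inverse squares over the window: `Σ_{|n| ≤ K, |β+n| ≥ L} 1/(β+n)² ≤ 2/(L−4)` for `L ≥ 5` and `|β| ≤ 1`
(modes with `|β + n| ≥ L` have `|n| ≥ L − 1`, and `1/(β+n)² ≤ 1/(|n|−1)²`). [folklore] -/
theorem sum_Icc_inv_sq_far_le {β : ℝ} (hβ : |β| ≤ 1) {L : ℝ} (hL : 5 ≤ L) (K : ℕ) :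
    ∑ n ∈ Finset.Icc (-(K : ℤ)) K, (if |β + n| < L then (0 : ℝ) else 1 / (β + n) ^ 2) ≤ 2 / (L - 4) := by
  -- threshold window `K₀ = ⌊L⌋ - 2 ≥ 2`: `|β+n| ≥ L ⇒ |n| ≥ L - 1 > ⌊L⌋ - 2`
  obtain ⟨K₀, hK₀def⟩ : ∃ K₀ : ℕ, (K₀ : ℤ) = ⌊L⌋ - 2 := ⟨(⌊L⌋ - 2).toNat, Int.toNat_of_nonneg (by
    have : (5 : ℤ) ≤ ⌊L⌋ := Int.le_floor.2 (by exact_mod_cast hL); omega)⟩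
  have hfl : ((⌊L⌋ : ℤ) : ℝ) ≤ L := Int.floor_le L
  have hfl' : L < ((⌊L⌋ : ℤ) : ℝ) + 1 := Int.lt_floor_add_one L
  have hK₀r : (K₀ : ℝ) = ((⌊L⌋ : ℤ) : ℝ) - 2 := by exact_mod_cast hK₀def
  have hK₀2 : 2 ≤ K₀ := by
    have : (5 : ℤ) ≤ ⌊L⌋ := Int.le_floor.2 (by exact_mod_cast hL)
    omega
  have hpt : ∀ n : ℤ, n ∈ Finset.Icc (-(K : ℤ)) K →
      (if |β + n| < L then (0 : ℝ) else 1 / (β + n) ^ 2) ≤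
        (if n ∈ Finset.Icc (-(K₀ : ℤ)) K₀ then (0 : ℝ) else 1 / ((|(n : ℝ)| - 1) ^ 2)) := by
    intro n _
    by_cases hlt : |β + n| < L
    · rw [if_pos hlt]; split_ifs <;> positivity
    · rw [if_neg hlt]
      replace hlt := not_lt.mp hlt
      have hn1 : L - 1 ≤ |(n : ℝ)| := by
        have := abs_add_le β (n : ℝ); linarith
      have hnot : n ∉ Finset.Icc (-(K₀ : ℤ)) K₀ := by
        rw [Finset.mem_Icc, not_and_or, not_le, not_le]
        have h3 : (K₀ : ℝ) < |(n : ℝ)| := by linarith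
        rcases le_or_gt 0 n with hn | hn
        · right
          have : (K₀ : ℝ) < (n : ℝ) := by rw [abs_of_nonneg (by exact_mod_cast hn)] at h3; exact h3
          exact_mod_cast this
        · left
          have : (K₀ : ℝ) < -(n : ℝ) := by rw [abs_of_neg (by exact_mod_cast hn)] at h3; exact h3
          have : (n : ℝ) < -(K₀ : ℝ) := by linarith
          exact_mod_cast this
      rw [if_neg hnot]
      have hpos : 0 < |(n : ℝ)| - 1 := by linarith
      refine div_le_div_of_nonneg_left (by norm_num) (by positivity) ?_
      have : |(n : ℝ)| - 1 ≤ |β + n| := by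
        have h := abs_add_le (β + n) (-β)
        rw [abs_neg, show β + (n : ℝ) + -β = n by ring] at h
        linarith
      calc (|(n : ℝ)| - 1) ^ 2 ≤ |β + n| ^ 2 := pow_le_pow_left₀ hpos.le this 2
        _ = (β + n) ^ 2 := sq_abs _
  rcases le_or_gt K₀ K with hK | hK
  · refine (Finset.sum_le_sum hpt).trans ((sum_Icc_tail_inv_sq_le hK₀2 hK).trans ?_)
    have h2 : (2 : ℝ) ≤ K := by exact_mod_cast hK₀2.trans hK
    have hpos : 0 ≤ 2 / ((K : ℝ) - 1) := div_nonneg (by norm_num) (by linarith)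
    have hL3 : 0 < L - 4 := by linarith
    have : 2 / ((K₀ : ℝ) - 1) ≤ 2 / (L - 4) := div_le_div_of_nonneg_left (by norm_num) hL3 (by rw [hK₀r]; linarith)
    linarith
  · -- the whole window is inside the threshold window: every far term vanishes
    refine (Finset.sum_le_sum hpt).trans ?_
    rw [Finset.sum_eq_zero fun n hn => if_pos (by rw [Finset.mem_Icc] at hn ⊢; omega)]
    exact div_nonneg (by norm_num) (by linarith)

/-! ## §3 The square sum of the creation weights -/

/-- **THE SQUARE SUM OF THE CREATION WEIGHTS IS `O(a)`** (`a ≥ 4`, any Bloch phase with `|β| ≤ 1`, any window): with the near weight `0.889/a` on the modes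
`|β+n| < 16a` and the paired far weight `102a/(β+n)²` beyond,
`Σ_{|n| ≤ K} W(a,β+n)²·(a²+(β+n)²) ≤ 8000·a`. This is the constant of the energy-form creation law: `‖q‖² ≤ (Σ_n W_n²(a²+ξ_n²))·Σ_n ‖c n‖²/(a²+ξ_n²)`
by Cauchy–Schwarz. [folklore] -/
theorem sum_sq_creationWeight_le {a : ℝ} (ha : 4 ≤ a) {β : ℝ} (hβ : |β| ≤ 1) (K : ℕ) :
    ∑ n ∈ Finset.Icc (-(K : ℤ)) K,
        (if |β + n| < 16 * a then (0.889 / a) ^ 2 * (a ^ 2 + (β + n) ^ 2) else (102 * a / (β + n) ^ 2) ^ 2 * (a ^ 2 + (β + n) ^ 2)) ≤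
      8000 * a := by
  have ha0 : 0 < a := by linarith
  -- near part: each term ≤ 0.889²·257 and there are at most `32a + 1` of them
  have hnear : ∑ n ∈ Finset.Icc (-(K : ℤ)) K, (if |β + n| < 16 * a then (0.889 / a) ^ 2 * (a ^ 2 + (β + n) ^ 2) else 0) ≤
      204 * (2 * (16 * a) + 1) := by
    have hpt : ∀ n ∈ Finset.Icc (-(K : ℤ)) K, (if |β + n| < 16 * a then (0.889 / a) ^ 2 * (a ^ 2 + (β + n) ^ 2) else (0 : ℝ)) ≤
        if |β + n| < 16 * a then (204 : ℝ) else 0 := by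
      intro n _
      split_ifs with h
      · have hb : (β + n) ^ 2 < (16 * a) ^ 2 := by
          have := abs_lt.1 h; nlinarith [this.1, this.2]
        rw [div_pow, div_mul_eq_mul_div, div_le_iff₀ (by positivity)]
        nlinarith
      · exact le_rfl
    refine (Finset.sum_le_sum hpt).trans ?_
    rw [← Finset.sum_filter, Finset.sum_const, nsmul_eq_mul]
    have hc := card_filter_abs_lt_le β (show 0 ≤ 16 * a by positivity) (Finset.Icc (-(K : ℤ)) K)
    nlinarith
  -- far part: each term ≤ 10445·a²/(β+n)²
  have hfar : ∑ n ∈ Finset.Icc (-(K : ℤ)) K, (if |β + n| < 16 * a then 0 else (102 * a / (β + n) ^ 2) ^ 2 * (a ^ 2 + (β + n) ^ 2)) ≤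
      10445 * a ^ 2 * (2 / (16 * a - 4)) := by
    have hpt : ∀ n ∈ Finset.Icc (-(K : ℤ)) K, (if |β + n| < 16 * a then (0 : ℝ) else (102 * a / (β + n) ^ 2) ^ 2 * (a ^ 2 + (β + n) ^ 2)) ≤
        10445 * a ^ 2 * (if |β + n| < 16 * a then (0 : ℝ) else 1 / (β + n) ^ 2) := by
      intro n _
      split_ifs with h
      · simp
      · replace h := not_lt.mp h
        have hb2 : (16 * a) ^ 2 ≤ (β + n) ^ 2 := by
          calc (16 * a) ^ 2 ≤ |β + n| ^ 2 := pow_le_pow_left₀ (by positivity) h 2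
            _ = (β + n) ^ 2 := sq_abs _
        have hb0 : 0 < (β + n) ^ 2 := by nlinarith
        rw [div_pow, div_mul_eq_mul_div, show 10445 * a ^ 2 * (1 / (β + ↑n) ^ 2) = 10445 * a ^ 2 / (β + n) ^ 2 by ring,
          div_le_div_iff₀ (by positivity) hb0]
        -- `(102a)²(a² + b²)·b² ≤ 10445 a² (b²)²`, i.e. `10404(a² + b²) ≤ 10445 b²`, from `256 a² ≤ b²`
        have h41 : 10404 * a ^ 2 ≤ 41 * (β + n) ^ 2 := by nlinarith [hb2]
        have key : (102 * a) ^ 2 * (a ^ 2 + (β + n) ^ 2) ≤ 10445 * a ^ 2 * (β + n) ^ 2 := by nlinarith [h41, sq_nonneg a]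
        calc (102 * a) ^ 2 * (a ^ 2 + (β + ↑n) ^ 2) * (β + ↑n) ^ 2 ≤ 10445 * a ^ 2 * (β + n) ^ 2 * (β + n) ^ 2 :=
              mul_le_mul_of_nonneg_right key hb0.le
          _ = 10445 * a ^ 2 * ((β + ↑n) ^ 2) ^ 2 := by ring
    refine (Finset.sum_le_sum hpt).trans ?_
    rw [← Finset.mul_sum]
    exact mul_le_mul_of_nonneg_left (sum_Icc_inv_sq_far_le hβ (by linarith) K) (by positivity)
  -- combine
  have hsplit : ∑ n ∈ Finset.Icc (-(K : ℤ)) K,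
        (if |β + n| < 16 * a then (0.889 / a) ^ 2 * (a ^ 2 + (β + n) ^ 2) else (102 * a / (β + n) ^ 2) ^ 2 * (a ^ 2 + (β + n) ^ 2)) =
      (∑ n ∈ Finset.Icc (-(K : ℤ)) K, (if |β + n| < 16 * a then (0.889 / a) ^ 2 * (a ^ 2 + (β + n) ^ 2) else 0)) +
        ∑ n ∈ Finset.Icc (-(K : ℤ)) K, (if |β + n| < 16 * a then 0 else (102 * a / (β + n) ^ 2) ^ 2 * (a ^ 2 + (β + n) ^ 2)) := by
    rw [← Finset.sum_add_distrib]
    exact Finset.sum_congr rfl fun n _ => by split_ifs <;> simp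
  rw [hsplit]
  refine (add_le_add hnear hfar).trans ?_
  have h16 : 15 * a ≤ 16 * a - 4 := by linarith
  have hq : 2 / (16 * a - 4) ≤ 2 / (15 * a) := div_le_div_of_nonneg_left (by norm_num) (by positivity) h16
  have h1 : 10445 * a ^ 2 * (2 / (16 * a - 4)) ≤ 10445 * a ^ 2 * (2 / (15 * a)) := mul_le_mul_of_nonneg_left hq (by positivity)
  have h2 : 10445 * a ^ 2 * (2 / (15 * a)) ≤ 1393 * a := by
    rw [mul_div_assoc', div_le_iff₀ (by positivity)]; nlinarith
  nlinarith

end Summit.AnomalousDissipation.AnomalousDissipation.Theorems.SawtoothPulseCascade.K2PhaseBudget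

end
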